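import Summits.BirchSwinnertonDyer.BirchSwinnertonDyer.Theorems.ManinLocalTwoThreeGenerationTwoParabolic
import HarnessLib

/-!
# E-es-22 through PARABOLIC relative Ihara, guarded moduli (the consumer clone of MEMO-es §25 for `stub_cThreeImageResidual`)

Summit `BirchSwinnertonDyer`, route `ManinLocalTwoThree` (cell bsd-f2-manin), crux C2 `ManinOddAtFour` (stmt-BirchSwinnertonDyer-22967),
registered stub `stub_cThreeImageResidual` (the 3 950 `C₃`-image classes; also bears on crux C3 stmt-BirchSwinnertonDyer-22968 through
the shared leaf family).  Sequel to `Theorems/ManinLocalTwoThreeGenerationTwoParabolic.lean` (p3): the same parabolic telescope, with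
the odd-prime vanishing hypothesis required only at the primes `t ∥ N` (`t ∣ N`, `t² ∤ N`) that the telescope actually uses — which
is exactly the scope where the planner's E-es-40 (`NotTrivialEisensteinOfIrreducibleTwo`: hNT(t) for `W[2]` irreducible and
`t = 2 ∨ t² ∤ N`) and E-es-36o (`RelativeIharaShiftVanishingParOdd`) apply (MEMO-es §25.1, §25.4).

* `functional_eq_zero_of_parabolicShiftVanishing_two_of_dvd` — per-curve core, guarded;
* **`multiShiftClassGenerationTwo_of_parabolicVanishing_of_dvd`** — E-es-22 for all `W[2]`-irreducible classes (including `C₃`)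
  from parabolic relative Ihara for the curve's own system at `(2,2,3)` and at `(2,t,1)`, `t ∥ N`.

Nothing about BSD or Manin's conjecture is proved here.  References: HOME/MEMO-es.md §25 (cell bsd-f2-manin).
-/

set_option autoImplicit false
set_option linter.dupNamespace false

noncomputable section

open scoped Classical MatrixGroups ModularForm BigOperators

open CongruenceSubgroup Matrix.SpecialLinearGroup ModularGroup
  Literature.NumberTheory.EllipticCurves Literature.NumberTheory.EllipticCurves.ModularForms
  Literature.NumberTheory.EllipticCurves.ModularForms.HidaCohomology
  Summit.BirchSwinnertonDyer.Rank1Residual.ManinAdditive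

namespace Summit.BirchSwinnertonDyer.BirchSwinnertonDyer.Theorems.ManinLocalTwoThree

/-- **Per-curve core at `p = 2`, parabolic form, guarded moduli**: as `functional_eq_zero_of_parabolicShiftVanishing_two`, but the
odd-prime vanishing hypothesis is only required for the primes `t ∥ N` (`t ∣ N`, `t² ∤ N`) that the telescope actually uses —
the scope of E-es-40 / E-es-36o in MEMO-es §25. [folklore] -/
theorem functional_eq_zero_of_parabolicShiftVanishing_two_of_dvd {W : WeierstrassCurve ℚ} [W.IsElliptic] {N : ℕ} [NeZero N]
    {f : CuspForm (Gamma0 N) 2} (hf : IsNewformOf W f) (h4 : 2 ^ 2 ∣ N) (φ : ↥(periodLattice f) →+ ZMod 2)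
    (hφ : ∀ x : ↥(periodLattice f), (x : ℂ) ∈
      periodLattice (∑ T ∈ (insert 8 (N.primeFactors.filter fun q => ¬ q ^ 2 ∣ N)).powerset,
        (-1 : ℂ) ^ T.card • degeneracyMap0 N (8 * N ^ 2) (∏ t ∈ T, t - 1 + 1) 2 f) → φ x = 0)
    (hvan8 : ∀ (L' : ℕ) [NeZero L'] (S : Finset ℕ) (v : cocycles 0 L' (ZMod 2)), N ∣ L' →
      (∀ q : ℕ, q.Prime → q ∣ 2 * 2 * L' → q ∈ S) →
      IsHeckeGenEigenvector S (fun ℓ : ℕ => ((W.LFunction ℓ : ℤ) : ZMod 2)) v →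
      (∀ γ : Gamma0 L', ∀ c : OnePoint ℚ, mapGL ℚ (γ : SL(2, ℤ)) • c = c → (v : Gamma0 L' → Fin 1 → ZMod 2) γ 0 = 0) →
      degeneracyPullback 0 L' (L' * 2 ^ 3) (2 ^ 3) (ZMod 2) dvd_rfl (v : Gamma0 L' → Fin 1 → ZMod 2) =
        degeneracyPullback 0 L' (L' * 2 ^ 3) 1 (ZMod 2) (by simp) (v : Gamma0 L' → Fin 1 → ZMod 2) →
      v = 0)
    (hvanq : ∀ t : ℕ, t.Prime → t ≠ 2 → t ∣ N → ¬ t ^ 2 ∣ N →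
      ∀ (L' : ℕ) [NeZero L'] [NeZero t] (S : Finset ℕ) (v : cocycles 0 L' (ZMod 2)), N ∣ L' →
      (∀ q : ℕ, q.Prime → q ∣ 2 * t * L' → q ∈ S) →
      IsHeckeGenEigenvector S (fun ℓ : ℕ => ((W.LFunction ℓ : ℤ) : ZMod 2)) v →
      (∀ γ : Gamma0 L', ∀ c : OnePoint ℚ, mapGL ℚ (γ : SL(2, ℤ)) • c = c → (v : Gamma0 L' → Fin 1 → ZMod 2) γ 0 = 0) →
      degeneracyPullback 0 L' (L' * t ^ 1) (t ^ 1) (ZMod 2) dvd_rfl (v : Gamma0 L' → Fin 1 → ZMod 2) =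
        degeneracyPullback 0 L' (L' * t ^ 1) 1 (ZMod 2) (by simp) (v : Gamma0 L' → Fin 1 → ZMod 2) →
      v = 0) :
    φ = 0 := by
  haveI : Fact (Nat.Prime 2) := ⟨Nat.prime_two⟩
  have hN0 : 0 < N := Nat.pos_of_ne_zero (NeZero.ne N)
  have h4' : 4 ∣ N := by norm_num at h4; exact h4
  have h2N : 2 ∣ N := dvd_trans (by norm_num) h4'
  set G : Finset ℕ := N.primeFactors.filter fun q => ¬ q ^ 2 ∣ N with hG
  have hGprime : ∀ q ∈ G, q.Prime ∧ ¬ q ^ 2 ∣ N := fun q hq => by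
    rw [hG, Finset.mem_filter] at hq
    exact ⟨(Nat.mem_primeFactors.mp hq.1).1, hq.2⟩
  have hGne2 : ∀ q ∈ G, q ≠ 2 := by
    rintro q hq rfl
    exact (hGprime 2 hq).2 h4
  set ds : List ℕ := (2 ^ 3) :: (G.toList.map fun t => t ^ 1) with hds
  have hmap : (G.toList.map fun t => t ^ 1) = G.toList := by simp
  have h8G : (2 ^ 3 : ℕ) ∉ G.toList := fun h => by
    have h8 := (hGprime _ (Finset.mem_toList.mp h)).1
    norm_num at h8
  have hnd : ds.Nodup := by
    rw [hds, hmap]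
    exact List.nodup_cons.mpr ⟨h8G, Finset.nodup_toList G⟩
  have hpos : ∀ d ∈ ds, 0 < d := by
    intro d hd
    rw [hds, hmap] at hd
    rcases List.mem_cons.mp hd with rfl | hd
    · norm_num
    · exact (hGprime d (Finset.mem_toList.mp hd)).1.pos
  have hdsF : ds.toFinset = insert 8 G := by
    rw [hds, hmap, List.toFinset_cons, Finset.toList_toFinset]
    norm_num
  have hprod0 : ds.prod ≠ 0 := fun h0 => lt_irrefl 0 (hpos 0 (List.prod_eq_zero_iff.mp h0))
  set M : ℕ := N * ds.prod with hM
  have hM0 : M ≠ 0 := Nat.mul_ne_zero (NeZero.ne N) hprod0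
  haveI : NeZero M := ⟨hM0⟩
  have hNM : N ∣ M := dvd_mul_right N _
  have hL : 1 < M := lt_of_lt_of_le (by omega : 1 < N) (Nat.le_of_dvd (Nat.pos_of_ne_zero hM0) hNM)
  set S : Finset ℕ := M.primeFactors with hS
  have hSM : ∀ q : ℕ, q.Prime → q ∣ M → q ∈ S := fun q hq hqd =>
    (Nat.mem_primeFactors_of_ne_zero hM0).mpr ⟨hq, hqd⟩
  set u : cocycles 0 N (ZMod 2) :=
    ⟨fun (γ : Gamma0 N) (_ : Fin 1) => φ ⟨cuspSymbol f γ, cuspSymbol_mem_periodLattice f γ⟩,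
      functionalCocycle_mem_cocycles f φ⟩ with hu
  have hgen : IsHeckeGenEigenvector S (fun ℓ : ℕ => ((W.LFunction ℓ : ℤ) : ZMod 2)) u :=
    isHeckeGenEigenvector_functionalCocycle hf φ S
  have hupar : ∀ γ : Gamma0 N, ∀ c : OnePoint ℚ, mapGL ℚ (γ : SL(2, ℤ)) • c = c →
      (u : Gamma0 N → Fin 1 → ZMod 2) γ 0 = 0 := fun γ c hc => periodFunctional_parabolic f φ γ hc
  have hRI : ∀ d ∈ ds, ∀ (L' : ℕ) [NeZero L'] [NeZero d] (v : cocycles 0 L' (ZMod 2)), N ∣ L' →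
      (∀ q : ℕ, q.Prime → q ∣ L' * d → q ∈ S) →
      IsHeckeGenEigenvector S (fun ℓ : ℕ => ((W.LFunction ℓ : ℤ) : ZMod 2)) v →
      (∀ γ : Gamma0 L', ∀ c : OnePoint ℚ, mapGL ℚ (γ : SL(2, ℤ)) • c = c → (v : Gamma0 L' → Fin 1 → ZMod 2) γ 0 = 0) →
      degeneracyPullback 0 L' (L' * d) d (ZMod 2) dvd_rfl (v : Gamma0 L' → Fin 1 → ZMod 2) =
        degeneracyPullback 0 L' (L' * d) 1 (ZMod 2) (by simp) (v : Gamma0 L' → Fin 1 → ZMod 2) →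
      v = 0 := by
    intro d hd
    rw [hds] at hd
    rcases List.mem_cons.mp hd with rfl | hd
    · intro L' _ _ v hNL hS' hv hvp heq
      refine hvan8 L' S v hNL (fun q hq hqd => ?_) hv hvp heq
      rcases (Nat.Prime.dvd_mul hq).mp hqd with h | h
      · have h2 : q ∣ 2 := by rcases (Nat.Prime.dvd_mul hq).mp h with h | h <;> exact h
        have hq2 : q = 2 := (Nat.prime_dvd_prime_iff_eq hq Nat.prime_two).mp h2
        subst hq2
        exact hS' 2 hq (dvd_mul_of_dvd_right (by norm_num) _)
      · exact hS' q hq (h.mul_right _)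
    · obtain ⟨t, ht, rfl⟩ := List.mem_map.mp hd
      have htp := (hGprime t (Finset.mem_toList.mp ht)).1
      have ht2 := hGne2 t (Finset.mem_toList.mp ht)
      have htsq := (hGprime t (Finset.mem_toList.mp ht)).2
      have htN : t ∣ N := by
        have hmem := Finset.mem_toList.mp ht
        rw [hG, Finset.mem_filter] at hmem
        exact Nat.dvd_of_mem_primeFactors hmem.1
      intro L' _ _ v hNL hS' hv hvp heq
      haveI : NeZero t := ⟨htp.ne_zero⟩
      refine hvanq t htp ht2 htN htsq L' S v hNL (fun q hq hqd => ?_) hv hvp heq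
      rcases (Nat.Prime.dvd_mul hq).mp hqd with h | h
      · rcases (Nat.Prime.dvd_mul hq).mp h with h | h
        · have hq2 : q = 2 := (Nat.prime_dvd_prime_iff_eq hq Nat.prime_two).mp h
          subst hq2
          exact hS' 2 hq ((h2N.trans hNL).mul_right _)
        · exact hS' q hq (dvd_mul_of_dvd_right (by rw [pow_one]; exact h) _)
      · exact hS' q hq (h.mul_right _)
  have hsum : ∀ (γ : Gamma0 M) (i : Fin 1),
      ∑ T ∈ ds.toFinset.powerset,
        (-1 : ℤ) ^ T.card • (u : Gamma0 N → Fin 1 → ZMod 2) (conjAt N M (∏ t ∈ T, t) γ) i = 0 := by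
    intro γ i
    have he : ((γ : SL(2, ℤ)) 1 1 : ℤ) ≠ 0 := apply_one_one_ne_zero_of_one_lt hL γ
    have hterm : ∀ T ∈ ds.toFinset.powerset,
        (-1 : ℤ) ^ T.card • (u : Gamma0 N → Fin 1 → ZMod 2) (conjAt N M (∏ t ∈ T, t) γ) i =
          φ ((-1 : ℤ) ^ T.card •
            ⟨cuspSymbol f (conjAt N M (∏ t ∈ T, t) γ), cuspSymbol_mem_periodLattice f _⟩) := by
      intro T _
      rw [map_zsmul]
    rw [Finset.sum_congr rfl hterm, ← map_sum]
    apply hφ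
    rw [AddSubmonoidClass.coe_finsetSum, periodLattice_multiShiftOldform_eq_closure_columns f h4', ← hdsF]
    apply AddSubgroup.subset_closure
    refine ⟨((γ : SL(2, ℤ)) 0 1 : ℤ), ((γ : SL(2, ℤ)) 1 1 : ℤ), he, ?_, ?_⟩
    · have hN' : IsCoprime ((γ : SL(2, ℤ)) 1 1 : ℤ) (M : ℤ) := isCoprime_apply_one_one_level γ
      exact (hN'.of_isCoprime_of_dvd_right (Int.natCast_dvd_natCast.mpr hNM)).mul_right
        (isCoprime_apply_zero_one_apply_one_one γ).symm
    · refine Finset.sum_congr rfl fun T hT => ?_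
      have hTpos : (∏ t ∈ T, t) ≠ 0 := Finset.prod_ne_zero_iff.mpr fun t ht =>
        (hpos t (List.mem_toFinset.mp (Finset.mem_powerset.mp hT ht))).ne'
      haveI : NeZero (∏ t ∈ T, t) := ⟨hTpos⟩
      have hTdvd : N * ∏ t ∈ T, t ∣ M := by
        refine mul_dvd_mul_left N ?_
        have hprod : ds.prod = ∏ t ∈ ds.toFinset, t := by
          rw [List.prod_toFinset (fun t : ℕ => t) hnd, List.map_id']
        rw [hprod]
        exact Finset.prod_dvd_prod_of_subset _ _ _ (Finset.mem_powerset.mp hT)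
      have h01 : ((Gamma0.degeneracyConj N M (∏ t ∈ T, t) hTdvd γ : SL(2, ℤ)) 0 1 : ℤ) =
          ((∏ t ∈ T, t : ℕ) : ℤ) * (γ : SL(2, ℤ)) 0 1 := rfl
      have h11 : ((Gamma0.degeneracyConj N M (∏ t ∈ T, t) hTdvd γ : SL(2, ℤ)) 1 1 : ℤ) =
          (γ : SL(2, ℤ)) 1 1 := rfl
      rw [AddSubgroupClass.coe_zsmul]
      show (-1 : ℤ) ^ T.card • cuspSymbol f (conjAt N M (∏ t ∈ T, t) γ) = _
      rw [conjAt_eq hTdvd γ, cuspSymbol_eq_modularSymbol_div_sub f _ (by rw [h11]; exact he), h01, h11,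
        zsmul_eq_mul]
      have harg : ((((∏ t ∈ T, t : ℕ) : ℤ) * (γ : SL(2, ℤ)) 0 1 : ℤ) : ℚ) / (((γ : SL(2, ℤ)) 1 1 : ℤ) : ℚ) =
          ((((γ : SL(2, ℤ)) 0 1 * ∏ t ∈ T, (t : ℤ) : ℤ)) : ℚ) / (((γ : SL(2, ℤ)) 1 1 : ℤ) : ℚ) := by
        push_cast
        ring
      rw [harg]
      push_cast
      ring
  have hu0 : u = 0 :=
    eq_zero_of_altSum_conjAt_eq_zero_parabolic S _ N ds hnd hpos hRI N M (dvd_refl N) hM hSM u hgen hupar hsum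
  ext x
  have hx : (x : ℂ) ∈ (periodLattice f : Set ℂ) := x.2
  rw [coe_periodLattice_eq_range] at hx
  obtain ⟨γ, hγ⟩ := hx
  have hxγ : x = ⟨cuspSymbol f γ, cuspSymbol_mem_periodLattice f γ⟩ := Subtype.ext hγ.symm
  have h0 : (u : Gamma0 N → Fin 1 → ZMod 2) γ 0 = 0 := by rw [hu0]; rfl
  rw [hxγ, AddMonoidHom.zero_apply]
  exact h0


/-- **E-es-22 for ALL `W[2]`-irreducible classes from PARABOLIC relative Ihara, guarded moduli** (the consumer clone for
MEMO-es §25 / stub 3: the odd-prime instances are needed only at `t ∥ N`, where E-es-40 supplies hNT(t)). [folklore] -/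
theorem multiShiftClassGenerationTwo_of_parabolicVanishing_of_dvd
    (hvan8 : ∀ (W : WeierstrassCurve ℚ) [W.IsElliptic], W.HasIrreducibleModPGaloisRep 2 →
      ∀ (L' : ℕ) [NeZero L'] (S : Finset ℕ) (v : cocycles 0 L' (ZMod 2)),
      (∀ q : ℕ, q.Prime → q ∣ 2 * 2 * L' → q ∈ S) →
      IsHeckeGenEigenvector S (fun ℓ : ℕ => ((W.LFunction ℓ : ℤ) : ZMod 2)) v →
      (∀ γ : Gamma0 L', ∀ c : OnePoint ℚ, mapGL ℚ (γ : SL(2, ℤ)) • c = c → (v : Gamma0 L' → Fin 1 → ZMod 2) γ 0 = 0) →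
      degeneracyPullback 0 L' (L' * 2 ^ 3) (2 ^ 3) (ZMod 2) dvd_rfl (v : Gamma0 L' → Fin 1 → ZMod 2) =
        degeneracyPullback 0 L' (L' * 2 ^ 3) 1 (ZMod 2) (by simp) (v : Gamma0 L' → Fin 1 → ZMod 2) →
      v = 0)
    (hvanq : ∀ (W : WeierstrassCurve ℚ) [W.IsElliptic] {N : ℕ} [NeZero N] (f : CuspForm (Gamma0 N) 2), IsNewformOf W f →
      W.HasIrreducibleModPGaloisRep 2 → ∀ t : ℕ, t.Prime → t ≠ 2 → t ∣ N → ¬ t ^ 2 ∣ N →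
      ∀ (L' : ℕ) [NeZero L'] [NeZero t] (S : Finset ℕ) (v : cocycles 0 L' (ZMod 2)), N ∣ L' →
      (∀ q : ℕ, q.Prime → q ∣ 2 * t * L' → q ∈ S) →
      IsHeckeGenEigenvector S (fun ℓ : ℕ => ((W.LFunction ℓ : ℤ) : ZMod 2)) v →
      (∀ γ : Gamma0 L', ∀ c : OnePoint ℚ, mapGL ℚ (γ : SL(2, ℤ)) • c = c → (v : Gamma0 L' → Fin 1 → ZMod 2) γ 0 = 0) →
      degeneracyPullback 0 L' (L' * t ^ 1) (t ^ 1) (ZMod 2) dvd_rfl (v : Gamma0 L' → Fin 1 → ZMod 2) =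
        degeneracyPullback 0 L' (L' * t ^ 1) 1 (ZMod 2) (by simp) (v : Gamma0 L' → Fin 1 → ZMod 2) →
      v = 0) :
    MultiShiftClassGenerationTwo := by
  haveI : Fact (Nat.Prime 2) := ⟨Nat.prime_two⟩
  rw [multiShiftClassGenerationTwo_iff_functionals]
  intro W _ N _ f hf h4 hirr φ hφ
  refine functional_eq_zero_of_parabolicShiftVanishing_two_of_dvd hf h4 φ hφ ?_ ?_
  · intro L' _ S v _ hS hv hvp heq
    exact hvan8 W hirr L' S v hS hv hvp heq
  · intro t ht ht2 htN htsq L' _ _ S v hNL hS hv hvp heq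
    exact hvanq W f hf hirr t ht ht2 htN htsq L' S v hNL hS hv hvp heq

end Summit.BirchSwinnertonDyer.BirchSwinnertonDyer.Theorems.ManinLocalTwoThree

end
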